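import Summits.FinalStateConjecture.FinalStateConjecture.Theses.ExactKerrEnds
import Summits.FinalStateConjecture.FinalStateConjecture.Theorems.ExactKerrEndsTrivialDatumWitness
import Literature.Geometry.Lorentzian.TameGaugedFamily
import Literature.Geometry.Lorentzian.ExactKerrEnd
import HarnessLib

/-!
# Crux `CensorshipAlongKerrEnds` (stmt-FinalStateConjecture-18521) NEEDS ONLY TAME CURVES:
# injectivity and immersion of the censored Kerr-ended witness curve are gauge-borne

The crux C₁ of route ExactKerrEnds asks, along every tame curve `F` of admissible data whose members off
`0` are Kerr-ended (immersed-injective, or constant), for a tame, INJECTIVE, IMMERSED curve `F'` of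
admissible data through `F 0` whose members off `0` are Kerr-ended AND censored. This file removes the
two gauge conditions from the obligation:

  `censorshipAlongKerrEnds_of_tameCurves : TameCensoredKerrEndedCurves → CensorshipAlongKerrEnds`,

where `TameCensoredKerrEndedCurves` (displayed verbatim as the hypothesis) asks, under the hypotheses of
the crux, merely for SOME tame curve `H` of admissible data with `H 0 = F 0` whose members off `0` are
Kerr-ended and censored — no injectivity, no immersion. Proof: the property
`P D := D.HasExactKerrEnd ∧ Censored D` is invariant under the breathing deformations of every end
(`InitialDataSet.HasExactKerrEnd.breatheFamily`, `censored_breatheFamily`), so the gauge-borne upgrade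
`Literature.Geometry.Lorentzian.InitialDataSet.exists_tameCurve_upgrade_of_breatheInvariant`
(`TameGaugedFamily.lean`: the breathing deformation of the quadratically reparametrised curve is tame
on a collared end, immersed at `0`, admissible, `P` off `0`; injectivity on a window) turns `H` into the
curve the crux asks for. The let-bound legend `KerrEnded` of the crux is `HasExactKerrEnd`
(`InitialDataSet.hasExactKerrEnd_iff`). Consequence for every line of C₁: its last step may deliver any
tame curve (sections of unfoldings, reparametrised rays, receding selections) without immersion or
injectivity bookkeeping.

References: Christodoulou, CQG 16 (1999) A23, pp. A24, A26–A27; Lee 2013, Prop. 2.25; Bartnik–Isenberg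
2004, §2; Choquet-Bruhat–Geroch 1969, p. 330.
-/

-- the doubled `FinalStateConjecture.FinalStateConjecture` path component trips dupNamespace
set_option linter.dupNamespace false

noncomputable section

open Set Function Filter TopologicalSpace
open scoped Manifold ContDiff Topology

namespace Summit.FinalStateConjecture.FinalStateConjecture.Theorems.ExactKerrEnds

open Literature.Geometry.Lorentzian

/-- **C₁ needs only tame curves**: if along every tame curve `F` of admissible data, immersed-injective
or constant, whose members off `0` are Kerr-ended there is SOME tame curve `H` of admissible data with
`H 0 = F 0` whose members off `0` are Kerr-ended and censored, then `CensorshipAlongKerrEnds` holds —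
the injective immersed witness is the gauge-borne upgrade of `H`
(`InitialDataSet.exists_tameCurve_upgrade_of_breatheInvariant` with the breathing-invariant property
"Kerr-ended and censored"). [cite: Christodoulou1999, p. A24] -/
theorem censorshipAlongKerrEnds_of_tameCurves :
    (∀ (X : Type) [TopologicalSpace X] [ChartedSpace E3 X] [IsManifold (𝓡 3) ∞ X] [T2Space X]
      [SecondCountableTopology X] [ConnectedSpace X],
      ∀ (e : AFEnd X) (F : EuclideanSpace ℝ (Fin 1) → InitialDataSet (𝓡 3) X),
        InitialDataSet.IsTameDataFamily e 1 F →
          ((InitialDataSet.IsImmersedAtZero 1 F ∧ Injective F) ∨ ∀ c, F c = F 0) →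
            (∀ c, F c ∈ admissibleVacuumData X) →
              (∀ c ≠ 0, (F c).HasExactKerrEnd) →
                ∃ (e' : AFEnd X) (H : EuclideanSpace ℝ (Fin 1) → InitialDataSet (𝓡 3) X),
                  InitialDataSet.IsTameDataFamily e' 1 H ∧ H 0 = F 0 ∧
                    (∀ c, H c ∈ admissibleVacuumData X) ∧
                      ∀ c ≠ 0, (H c).HasExactKerrEnd ∧
                        ∀ 𝒟 : VacuumCauchyDevelopment (H c), 𝒟.IsMaximal →
                          Summit.FinalStateConjecture.HasCompleteNullInfinity 𝒟.toCauchyDevelopment) →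
      Summit.FinalStateConjecture.FinalStateConjecture.Theses.ExactKerrEnds.CensorshipAlongKerrEnds := by
  intro hT X _ _ _ _ _ _ KerrEnded Censored e F hF hdich h𝓓 hQ
  -- the members off `0` of `F` are Kerr-ended (legend = `HasExactKerrEnd`, definitionally)
  have hQ' : ∀ c ≠ 0, (F c).HasExactKerrEnd := fun c hc ↦
    (InitialDataSet.hasExactKerrEnd_iff (F c)).2 (hQ c hc)
  -- a tame curve of admissible data through `F 0`, Kerr-ended and censored off `0`
  obtain ⟨e', H, hH, hH0, hHadm, hHgood⟩ := hT X e F hF hdich h𝓓 hQ'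
  -- the gauge-borne upgrade for the breathing-invariant property "Kerr-ended and censored"
  obtain ⟨e'', F', hF', hF'0, hinj, himm, hadm', hgood'⟩ :=
    InitialDataSet.exists_tameCurve_upgrade_of_breatheInvariant (e := e')
      (P := fun D : InitialDataSet (𝓡 3) X ↦ D.HasExactKerrEnd ∧
        ∀ 𝒟 : VacuumCauchyDevelopment D, 𝒟.IsMaximal →
          Summit.FinalStateConjecture.HasCompleteNullInfinity 𝒟.toCauchyDevelopment)
      (fun B d t hd ↦ ⟨InitialDataSet.HasExactKerrEnd.breatheFamily B hd.1 t,
        censored_breatheFamily B d t hd.2⟩) hH hHadm hHgood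
  exact ⟨e'', F', hF', hF'0.trans hH0, hinj, himm, hadm', fun c hc ↦
    ⟨(InitialDataSet.hasExactKerrEnd_iff (F' c)).1 (hgood' c hc).1, (hgood' c hc).2⟩⟩

end Summit.FinalStateConjecture.FinalStateConjecture.Theorems.ExactKerrEnds

end
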